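import Summits.QuantumAdvantage.QuantumAdvantage.Theorems.CubicForrelationNearExactIsExactZeroModSixPrep
import Summits.QuantumAdvantage.QuantumAdvantage.Theorems.CubicForrelationNearExactIsExactEighteenPairing

/-!
# Crux `CubicForrelation.NearExactIsExact` (stmt-QuantumAdvantage-14043) — `n = 6r`, TWO-SIDED: at level `≥ 2r+2` (`W_g ∈ 2^{2r+2}ℤ`) the
  second boundary value forces exactness: `Φ ≥ 1 − 2^{−2r} ⇒ Φ = 1` (`r ≥ 3`)

Certificate seat `b2b-cforr-cert` (gen 8).  HONEST FRAMING: a theorem uniform in `r` about cubic Boolean pairs on `6r` bits (the codimension-3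
and higher-level configurations at the SECOND dyadic boundary `1 − 2^{−n/3}` on `n ≡ 0 (mod 6)`); `r = 3` is the tree's `el8_levelEight_ge`;
NOT summit progress.

* `z2_high_levels` (`r ≥ 3`): if `W_g ∈ 2^{2r+3}ℤ` and `Φ ≥ 1 − 2^{−2r}` then `Φ = 1` — the tower walk `tms_walk_from` from level `2r+3` with cost
  exponent `2r−1` (every level `2r+3 ≤ j < 3r` costs `≥ 2^{−(2r−1)}`; top level `⌊3r/2⌋ + 1 ≤ 2r − 1`), and a bent `g` gives `Φ = 1` or
  `Φ ≤ 1 − 2^{1−⌊(3r+3)/2⌋} < 1 − 2^{−2r}`.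
* `z2_levelTwo_ge` (`r ≥ 3`): for cubic `f, g` with `W_g = 2^{2r+2}·u''` and `Φ ≥ 1 − 2^{−2r}`: `Φ = 1`.  If every `u''` is even this is
  `z2_high_levels`.  Otherwise `p = [u'' odd]` is cubic (tower), the budget `Σ(u − 2^r s)² = 16Σ(u'' − 2^{r−2}s)² = 2^{8r+1}(1−Φ) ≤ 2^{6r+1}`
  (`u = 4u''`) pays `≥ 16` per odd point and `RM(3,6r)` gives `#P ≥ 2^{6r−3}`: so `P = {u'' odd}` is a `(6r−3)`-FLAT `x₁ ⊕ V₀`, `u'' = 2^{r−2}s`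
  off `P`, `e := u'' − 2^{r−2}s = ±1` on `P`.  THREE directions with all seven combinations outside `V₀` (`ep_dirs3`); the general 6- and 7-flat
  sums (`16 ∣ Σ₆ u`, `32 ∣ Σ₇ u`; Ax for `f`) localise (`ep_loc3`) to `4Σ₃ e`, `4Σ₄ e` and give (H3)/(H4); the engine `fl1_flat_l1` yields
  `(Σ|(e1_P)^|)² ≤ 2^{12r+2}`, while the pairing needs `Σ_y (−1)^g (4e1_P)^(y) = 2^{8r}`, i.e. `(2^{8r−2})² ≤ 2^{12r+2}` — false for `r ≥ 2`.

References: J. Ax (1964) / R. J. McEliece (1972); MacWilliams–Sloane (1977) Ch. 13–15; X.-D. Hou (1998); R. O'Donnell (2014) §3.3.  Everything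
below is proved from Mathlib and the tree; axioms are the standard three.
-/

set_option linter.dupNamespace false -- D-0017: single-problem summit ⇒ `QuantumAdvantage.QuantumAdvantage` by design

noncomputable section

namespace Summit.QuantumAdvantage.QuantumAdvantage.Theorems.CubicForrelation.NearExactIsExact

open Finset
open Literature.Computability.QuantumComplexity
open Literature.Computability.QuantumComplexity.BuzetChailloux (bxor zeroVec bxor_bxor_cancel_left bxor_zeroVec zeroVec_bxor bxor_comm
  bxor_self)
open Literature.Computability.QuantumComplexity.DerivativeWalsh (W)

/-- **The levels `≥ 2r+3` on `6r` bits at the second boundary (`r ≥ 3`).**  If `W_g ∈ 2^{2r+3}ℤ` and `Φ(f,g) ≥ 1 − 2^{−2r}` then `Φ(f,g) = 1`: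
every level `2r+3 ≤ j ≤ 3r` of the tower costs at least `2^{−(2r−1)}`, and a bent `g` gives `Φ = 1` or `Φ ≤ 1 − 2^{1−⌊(3r+3)/2⌋} < 1 − 2^{−2r}`.
Uniform in `r`; NOT summit progress. [this work] -/
theorem z2_high_levels (r : ℕ) (hr : 3 ≤ r) (f g : (Fin (3 * r + 3 * r) → Bool) → Bool) (hf : IsDegLeFun 3 f)
    (hg : IsDegLeFun 3 g) (w : (Fin (3 * r + 3 * r) → Bool) → ℤ)
    (hw : ∀ x, W (fun y => signOf (g y)) x = (2 : ℝ) ^ (2 * r + 2 + 1) * (w x : ℝ))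
    (hΦ : 1 - (1 / 2 : ℝ) ^ (2 * r) ≤ forrelation f g) : forrelation f g = 1 := by
  obtain ⟨k, rfl⟩ : ∃ k, r = k + 3 := ⟨r - 3, by omega⟩
  rcases tms_walk_from (3 * (k + 3)) (2 * (k + 3) + 2 + 1) (2 * k + 5) g hg (by omega) (by omega) w hw
    (by intro j hj hjm; omega) (by omega) with hbent | hcap
  · rcases tw_bent_end (by omega) f g hf hg hbent with h | h
    · exact h
    · exfalso
      have hlt : (1 / 2 : ℝ) ^ (2 * (k + 3)) < 2 / 2 ^ ((3 * (k + 3) + 3) / 2) := by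
        have e : (2 : ℝ) / 2 ^ ((3 * (k + 3) + 3) / 2) = (1 / 2) ^ ((3 * (k + 3) + 3) / 2 - 1) := by
          obtain ⟨a, ha⟩ : ∃ a, (3 * (k + 3) + 3) / 2 = a + 1 := ⟨(3 * (k + 3) + 3) / 2 - 1, by omega⟩
          rw [ha, pow_succ, one_div_pow, Nat.add_sub_cancel]
          field_simp
        rw [e]
        exact pow_lt_pow_right_of_lt_one₀ (by norm_num) (by norm_num) (by omega)
      linarith
  · exfalso
    have := tw_forrelation_le_of_cap f g hcap
    have hlt : (1 / 2 : ℝ) ^ (2 * (k + 3)) < (1 / 2) ^ (2 * k + 5) :=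
      pow_lt_pow_right_of_lt_one₀ (by norm_num) (by norm_num) (by omega)
    linarith

/-- **Level `≥ 2r+2` on `6r` bits: `Φ ≥ 1 − 2^{−2r} ⇒ Φ = 1` (`r ≥ 3`).**  For cubic `f, g : 𝔽₂^{3r+3r} → 𝔽₂` with `W_g = 2^{2r+2}·u''` and
`Φ(f,g) ≥ 1 − (1/2)^{2r}` the pair is exact.  Uniform in `r`; NOT summit progress. [this work] -/
theorem z2_levelTwo_ge (r : ℕ) (hr : 3 ≤ r) (f g : (Fin (3 * r + 3 * r) → Bool) → Bool) (hf : IsDegLeFun 3 f) (hg : IsDegLeFun 3 g)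
    (u'' : (Fin (3 * r + 3 * r) → Bool) → ℤ) (hu'' : ∀ x, W (fun y => signOf (g y)) x = (2 : ℝ) ^ (2 * r + 2) * (u'' x : ℝ))
    (hΦ : 1 - (1 / 2 : ℝ) ^ (2 * r) ≤ forrelation f g) : forrelation f g = 1 := by
  classical
  -- level `≥ 2r+3`: the walk
  by_cases hall : ∀ x, ¬ Odd (u'' x)
  · exact z2_high_levels r hr f g hf hg _ (tw_level_up g u'' hu'' hall) hΦ
  exfalso
  push Not at hall
  obtain ⟨x₁, hx₁⟩ := hall
  obtain ⟨k, rfl⟩ : ∃ k, r = k + 3 := ⟨r - 3, by omega⟩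
  -- `u = 4u''` at the Ax level `2r`
  set u : (Fin (3 * (k + 3) + 3 * (k + 3)) → Bool) → ℤ := fun x => 4 * u'' x with hudef
  have hu : ∀ x, W (fun y => signOf (g y)) x = (2 : ℝ) ^ (2 * (k + 3)) * (u x : ℝ) := by
    intro x; rw [hu'' x]; simp only [u]; push_cast; ring
  -- the parity of `u''` is cubic
  have hp : IsDegLeFun 3 (fun x => decide (Odd (u'' x))) :=
    stub_walshTower stub_axParity (3 * (k + 3) + 3 * (k + 3)) (2 * (k + 3) + 2) 3 g u'' hg hu'' (by intro j hj hjn; omega)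
  have hp' : IsDegLeFun (2 + 1) (fun x => decide (Odd (u'' x))) := hp
  -- budget `Σ (u'' − 2^{r−2} s)² ≤ 2^{6r−3}`
  have hbud := zms_budget (k + 3) f g u hu
  have hpow : (2 : ℝ) ^ (8 * (k + 3) + 1) * (1 / 2) ^ (2 * (k + 3)) = 2 ^ (6 * k + 19) := by
    rw [one_div_pow]; field_simp; ring
  have hB0 : (∑ x, (u x - 2 ^ (k + 3) * sZ (f x)) ^ 2 : ℤ) ≤ 2 ^ (6 * k + 19) := by
    have h1 : 1 - forrelation f g ≤ (1 / 2 : ℝ) ^ (2 * (k + 3)) := by linarith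
    have h' : ((∑ x, (u x - 2 ^ (k + 3) * sZ (f x)) ^ 2 : ℤ) : ℝ) ≤ (2 : ℝ) ^ (6 * k + 19) := by
      rw [hbud, ← hpow]
      exact mul_le_mul_of_nonneg_left h1 (by positivity)
    exact_mod_cast h'
  have hpow4 : (2 : ℤ) ^ (k + 3) = 4 * 2 ^ (k + 1) := by ring
  have h16 : ∀ x, (u x - 2 ^ (k + 3) * sZ (f x)) ^ 2 = 16 * (u'' x - 2 ^ (k + 1) * sZ (f x)) ^ 2 := fun x => by
    simp only [u]; rw [hpow4]; ring
  have hB : (∑ x, (u'' x - 2 ^ (k + 1) * sZ (f x)) ^ 2 : ℤ) ≤ 2 ^ (6 * k + 15) := by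
    have h'' := hB0
    rw [sum_congr rfl fun x _ => h16 x, ← mul_sum, show (2 : ℤ) ^ (6 * k + 19) = 16 * 2 ^ (6 * k + 15) by ring] at h''
    linarith
  -- RM: `#P ≥ 2^{6r−3}`
  set P := univ.filter (fun x : Fin (3 * (k + 3) + 3 * (k + 3)) → Bool => Odd (u'' x)) with hPdef
  have hmemP : ∀ x, x ∈ P ↔ Odd (u'' x) := fun x => by simp [hPdef]
  have hfilt : (univ.filter fun x : Fin (3 * (k + 3) + 3 * (k + 3)) → Bool => decide (Odd (u'' x)) = true) = P :=
    filter_congr fun x _ => by simp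
  have hRM := bb_rmWeight_holds (3 * (k + 3) + 3 * (k + 3)) 3 (fun x => decide (Odd (u'' x))) hp ⟨x₁, by simpa using hx₁⟩
  rw [hfilt] at hRM
  have hPge : 2 ^ (6 * k + 15) ≤ #P := by
    have h2 : (2 : ℕ) ^ (3 * (k + 3) + 3 * (k + 3)) = 2 ^ 3 * 2 ^ (6 * k + 15) := by ring
    rw [h2] at hRM
    exact Nat.le_of_mul_le_mul_left hRM (by positivity)
  -- everything is tight
  have hsumP : (∑ x, (if Odd (u'' x) then 1 else 0 : ℤ)) = #P := by rw [sum_boole]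
  have hnonneg : ∀ x, 0 ≤ (u'' x - 2 ^ (k + 1) * sZ (f x)) ^ 2 - (if Odd (u'' x) then 1 else 0 : ℤ) := by
    intro x
    by_cases h : Odd (u'' x)
    · rw [if_pos h]
      have hodd' : Odd (u'' x - 2 ^ (k + 1) * sZ (f x)) := by
        have h2 : Even ((2 : ℤ) ^ (k + 1) * sZ (f x)) := by rw [pow_succ]; exact ⟨2 ^ k * sZ (f x), by ring⟩
        exact Int.odd_sub.2 (iff_of_true h h2)
      have h0 := Int.odd_iff.1 hodd'
      have : u'' x - 2 ^ (k + 1) * sZ (f x) ≤ -1 ∨ 1 ≤ u'' x - 2 ^ (k + 1) * sZ (f x) := by omega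
      have := tp_sq_ge (k := 1) (by norm_num) this
      linarith
    · rw [if_neg h]; have := sq_nonneg (u'' x - 2 ^ (k + 1) * sZ (f x)); linarith
  have hPge' : (2 : ℤ) ^ (6 * k + 15) ≤ #P := by exact_mod_cast hPge
  have hsum0 : ∑ x, ((u'' x - 2 ^ (k + 1) * sZ (f x)) ^ 2 - (if Odd (u'' x) then 1 else 0 : ℤ)) = 0 := by
    refine le_antisymm ?_ (sum_nonneg fun x _ => hnonneg x)
    rw [sum_sub_distrib, hsumP]
    linarith
  have hzero' : ∀ x, (u'' x - 2 ^ (k + 1) * sZ (f x)) ^ 2 - (if Odd (u'' x) then 1 else 0 : ℤ) = 0 :=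
    fun x => (sum_eq_zero_iff_of_nonneg fun y _ => hnonneg y).1 hsum0 x (mem_univ x)
  have hoff : ∀ x, ¬ Odd (u'' x) → u'' x - 2 ^ (k + 1) * sZ (f x) = 0 := by
    intro x hx
    have h := hzero' x
    rw [if_neg hx, sub_zero] at h
    exact (pow_eq_zero_iff two_ne_zero).1 h
  have hon : ∀ x, Odd (u'' x) → u'' x - 2 ^ (k + 1) * sZ (f x) = 1 ∨ u'' x - 2 ^ (k + 1) * sZ (f x) = -1 := by
    intro x hx
    have h := hzero' x
    rw [if_pos hx] at h
    have h1 : (u'' x - 2 ^ (k + 1) * sZ (f x)) * (u'' x - 2 ^ (k + 1) * sZ (f x)) = 1 := by rw [← pow_two]; linarith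
    exact mul_self_eq_one_iff.1 h1
  have hPcard : #P = 2 ^ (6 * k + 15) := by
    have hle : (#P : ℤ) ≤ 2 ^ (6 * k + 15) := by
      rw [← hsumP]
      exact le_trans (sum_le_sum fun x _ => by have := hnonneg x; linarith) hB
    have hle' : #P ≤ 2 ^ (6 * k + 15) := by exact_mod_cast hle
    exact le_antisymm hle' hPge
  have hTeq : (2 : ℝ) ^ (8 * (k + 3) + 1) * (1 - forrelation f g) = 2 ^ (6 * k + 19) := by
    have hT : (∑ x, (u x - 2 ^ (k + 3) * sZ (f x)) ^ 2 : ℤ) = 2 ^ (6 * k + 19) := by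
      have e16 : ∀ x, (u x - 2 ^ (k + 3) * sZ (f x)) ^ 2 = 16 * ((u'' x - 2 ^ (k + 1) * sZ (f x)) ^ 2 -
          (if Odd (u'' x) then 1 else 0 : ℤ)) + 16 * (if Odd (u'' x) then 1 else 0 : ℤ) := fun x => by rw [h16 x]; ring
      rw [sum_congr rfl fun x _ => e16 x, sum_add_distrib, ← mul_sum, ← mul_sum, hsum0, hsumP, hPcard]
      push_cast; ring
    have h : ((∑ x, (u x - 2 ^ (k + 3) * sZ (f x)) ^ 2 : ℤ) : ℝ) = 2 ^ (6 * k + 19) := by exact_mod_cast hT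
    rw [hbud] at h
    exact h
  -- `P` is a `(6r−3)`-flat
  have hmw := mw_flat_of_minweight 2 (fun x => decide (Odd (u'' x))) hp' (by rw [hfilt, hPcard]; ring)
  rw [hfilt] at hmw
  obtain ⟨h0, hadd, hcardV, hcoset⟩ := hmw
  set V₀ := univ.filter (fun a : Fin (3 * (k + 3) + 3 * (k + 3)) → Bool => ∀ x,
    decide (Odd (u'' (bxor x a))) = decide (Odd (u'' x))) with hV₀
  have hS : P = V₀.image (bxor x₁) := hcoset x₁ (by simpa using hx₁)
  rw [hPcard] at hcardV
  have hNcard : #(univ : Finset (Fin (3 * (k + 3) + 3 * (k + 3)) → Bool)) = 2 ^ (6 * k + 18) := by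
    rw [card_univ, Fintype.card_fun, Fintype.card_bool, Fintype.card_fin]; ring
  -- three transversal directions
  obtain ⟨t₁, -, t₂, -, t₃, -, n1, n2, n21, n3, n31, n32, n321⟩ := ep_dirs3 univ V₀ (by
    rw [hcardV, hNcard]
    have e : (2 : ℕ) ^ (6 * k + 18) = 8 * 2 ^ (6 * k + 15) := by ring
    rw [e]; have hX : 0 < 2 ^ (6 * k + 15) := Nat.two_pow_pos _; linarith)
  -- the sign pattern and the vanishing of the residual off `P`
  set e : (Fin (3 * (k + 3) + 3 * (k + 3)) → Bool) → ℤ := fun x => u'' x - 2 ^ (k + 1) * sZ (f x) with hedef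
  have he : ∀ x ∈ P, e x = 1 ∨ e x = -1 := fun x hx => hon x ((hmemP x).1 hx)
  have hF0 : ∀ y, y ∉ P → u y - 2 ^ (k + 3) * sZ (f y) = 0 := by
    intro y hy
    have := hoff y (fun h => hy ((hmemP y).2 h))
    simp only [u]; rw [hpow4]; linarith
  have hFe : ∀ y, u y - 2 ^ (k + 3) * sZ (f y) = 4 * e y := fun y => by simp only [u, e]; rw [hpow4]; ring
  have hPV : ∀ x, x ∈ P → ∀ a ∈ V₀, bxor x a ∈ P := fun x hx a ha => fl1_coset_vadd hadd hS hx ha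
  have hz : ∀ p ∈ P, ∀ w, w ∉ V₀ → u (bxor p w) - 2 ^ (k + 3) * sZ (f (bxor p w)) = 0 :=
    fun p hp w hw => hF0 _ (fl1_coset_out h0 hadd hS hp hw)
  -- localisation by the three directions
  have hloc : ∀ {kk : ℕ} (x : Fin (3 * (k + 3) + 3 * (k + 3)) → Bool) (a : Fin kk → Fin (3 * (k + 3) + 3 * (k + 3)) → Bool),
      (∀ ε : Fin kk → Bool, (fun j => x j ^^ decide (Odd #(univ.filter fun i => ε i && a i j))) ∈ P) →
      ∑ ε : Fin (kk + 3) → Bool, (u (fun j => x j ^^ decide (Odd #(univ.filter fun i =>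
          ε i && (Matrix.vecCons t₁ (Matrix.vecCons t₂ (Matrix.vecCons t₃ a)) :
            Fin (kk + 3) → Fin (3 * (k + 3) + 3 * (k + 3)) → Bool) i j))) -
        2 ^ (k + 3) * sZ (f (fun j => x j ^^ decide (Odd #(univ.filter fun i =>
          ε i && (Matrix.vecCons t₁ (Matrix.vecCons t₂ (Matrix.vecCons t₃ a)) :
            Fin (kk + 3) → Fin (3 * (k + 3) + 3 * (k + 3)) → Bool) i j))))) =
      ∑ ε : Fin kk → Bool, 4 * e (fun j => x j ^^ decide (Odd #(univ.filter fun i => ε i && a i j))) := by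
    intro kk x a hin
    have key := ep_loc3 (fun y => u y - 2 ^ (k + 3) * sZ (f y)) x t₁ t₂ t₃ a
      (fun ε => hz _ (hin ε) t₁ n1) (fun ε => hz _ (hin ε) t₂ n2)
      (fun ε => by rw [iw_bxor_assoc]; exact hz _ (hin ε) _ n21)
      (fun ε => hz _ (hin ε) t₃ n3)
      (fun ε => by rw [iw_bxor_assoc]; exact hz _ (hin ε) _ n31)
      (fun ε => by rw [iw_bxor_assoc]; exact hz _ (hin ε) _ n32)
      (fun ε => by rw [iw_bxor_assoc, iw_bxor_assoc]; exact hz _ (hin ε) _ n321)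
    beta_reduce at key
    rw [key]
    exact sum_congr rfl fun ε _ => hFe _
  -- (H3) and (H4)
  have H3 : ∀ x ∈ P, ∀ a b c : Fin (3 * (k + 3) + 3 * (k + 3)) → Bool, a ∈ V₀ → b ∈ V₀ → c ∈ V₀ →
      (4 : ℤ) ∣ ∑ ε : Fin 3 → Bool, e (fun j => x j ^^ decide (Odd #(univ.filter fun i =>
        ε i && (![a, b, c] : Fin 3 → Fin (3 * (k + 3) + 3 * (k + 3)) → Bool) i j))) := by
    intro x hx a b c ha hb hc
    have hin : ∀ ε : Fin 3 → Bool, (fun j => x j ^^ decide (Odd #(univ.filter fun i =>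
        ε i && (![a, b, c] : Fin 3 → Fin (3 * (k + 3) + 3 * (k + 3)) → Bool) i j))) ∈ P :=
      fun ε => fr_mem_flatPt3 V₀ h0 (· ∈ P) hPV hx ![a, b, c] (fun i => by fin_cases i <;> assumption) ε
    have h16f := fs_flat_sum_dvd (e := 4) g u hg hu x ![t₁, t₂, t₃, a, b, c] (by omega)
    obtain ⟨zf, hzf⟩ := sl_sum_sZ_flat f hf x ![t₁, t₂, t₃, a, b, c]
    have hzf' : ∑ ε : Fin 6 → Bool, 2 ^ (k + 3) * sZ (f (fun j => x j ^^ decide (Odd #(univ.filter fun i =>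
          ε i && (![t₁, t₂, t₃, a, b, c] : Fin 6 → Fin (3 * (k + 3) + 3 * (k + 3)) → Bool) i j)))) = 16 * (2 ^ (k + 1) * zf) := by
      rw [← mul_sum, hzf]; norm_num; ring
    have h16n : (16 : ℤ) ∣ ∑ ε : Fin 6 → Bool, u (fun j => x j ^^ decide (Odd #(univ.filter fun i =>
          ε i && (![t₁, t₂, t₃, a, b, c] : Fin 6 → Fin (3 * (k + 3) + 3 * (k + 3)) → Bool) i j))) := by
      have e16 : (2 : ℤ) ^ 4 = 16 := by norm_num
      rw [e16] at h16f; exact h16f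
    have h16' : (16 : ℤ) ∣ ∑ ε : Fin 6 → Bool, (u (fun j => x j ^^ decide (Odd #(univ.filter fun i =>
          ε i && (![t₁, t₂, t₃, a, b, c] : Fin 6 → Fin (3 * (k + 3) + 3 * (k + 3)) → Bool) i j))) -
        2 ^ (k + 3) * sZ (f (fun j => x j ^^ decide (Odd #(univ.filter fun i =>
          ε i && (![t₁, t₂, t₃, a, b, c] : Fin 6 → Fin (3 * (k + 3) + 3 * (k + 3)) → Bool) i j))))) := by
      rw [sum_sub_distrib, hzf']
      exact dvd_sub h16n (Dvd.intro _ rfl)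
    rw [hloc x ![a, b, c] hin, ← mul_sum] at h16'
    obtain ⟨k16, hk16⟩ := h16'
    exact ⟨k16, by linarith⟩
  have H4 : ∀ x ∈ P, ∀ a₀ a₁ a₂ a₃ : Fin (3 * (k + 3) + 3 * (k + 3)) → Bool, a₀ ∈ V₀ → a₁ ∈ V₀ → a₂ ∈ V₀ → a₃ ∈ V₀ →
      (8 : ℤ) ∣ ∑ ε : Fin 4 → Bool, e (fun j => x j ^^ decide (Odd #(univ.filter fun i =>
        ε i && (![a₀, a₁, a₂, a₃] : Fin 4 → Fin (3 * (k + 3) + 3 * (k + 3)) → Bool) i j))) := by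
    intro x hx a₀ a₁ a₂ a₃ ha₀ ha₁ ha₂ ha₃
    have hin : ∀ ε : Fin 4 → Bool, (fun j => x j ^^ decide (Odd #(univ.filter fun i =>
        ε i && (![a₀, a₁, a₂, a₃] : Fin 4 → Fin (3 * (k + 3) + 3 * (k + 3)) → Bool) i j))) ∈ P :=
      fun ε => fr_mem_flatPt4 V₀ h0 (· ∈ P) hPV hx ![a₀, a₁, a₂, a₃] (fun i => by fin_cases i <;> assumption) ε
    have h32 := fs_flat_sum_dvd (e := 5) g u hg hu x ![t₁, t₂, t₃, a₀, a₁, a₂, a₃] (by omega)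
    obtain ⟨zf, hzf⟩ := sl_sum_sZ_flat f hf x ![t₁, t₂, t₃, a₀, a₁, a₂, a₃]
    have hzf' : ∑ ε : Fin 7 → Bool, 2 ^ (k + 3) * sZ (f (fun j => x j ^^ decide (Odd #(univ.filter fun i =>
          ε i && (![t₁, t₂, t₃, a₀, a₁, a₂, a₃] : Fin 7 → Fin (3 * (k + 3) + 3 * (k + 3)) → Bool) i j)))) =
        32 * (2 ^ (k + 1) * zf) := by
      rw [← mul_sum, hzf]; norm_num; ring
    have h32n : (32 : ℤ) ∣ ∑ ε : Fin 7 → Bool, u (fun j => x j ^^ decide (Odd #(univ.filter fun i =>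
          ε i && (![t₁, t₂, t₃, a₀, a₁, a₂, a₃] : Fin 7 → Fin (3 * (k + 3) + 3 * (k + 3)) → Bool) i j))) := by
      have e32 : (2 : ℤ) ^ 5 = 32 := by norm_num
      rw [e32] at h32; exact h32
    have h32' : (32 : ℤ) ∣ ∑ ε : Fin 7 → Bool, (u (fun j => x j ^^ decide (Odd #(univ.filter fun i =>
          ε i && (![t₁, t₂, t₃, a₀, a₁, a₂, a₃] : Fin 7 → Fin (3 * (k + 3) + 3 * (k + 3)) → Bool) i j))) -
        2 ^ (k + 3) * sZ (f (fun j => x j ^^ decide (Odd #(univ.filter fun i =>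
          ε i && (![t₁, t₂, t₃, a₀, a₁, a₂, a₃] : Fin 7 → Fin (3 * (k + 3) + 3 * (k + 3)) → Bool) i j))))) := by
      rw [sum_sub_distrib, hzf']
      exact dvd_sub h32n (Dvd.intro _ rfl)
    rw [hloc x ![a₀, a₁, a₂, a₃] hin, ← mul_sum] at h32'
    obtain ⟨k32, hk32⟩ := h32'
    exact ⟨k32, by linarith⟩
  -- the engine and the pairing
  have hE := fl1_flat_l1 V₀ P x₁ h0 hadd hS e he H3 H4
  set A : (Fin (3 * (k + 3) + 3 * (k + 3)) → Bool) → ℝ := fun x => if x ∈ P then (e x : ℝ) else 0 with hA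
  have hAτ : (fun x => (u x : ℝ) - (2 : ℝ) ^ (k + 3) * signOf (f x)) = fun x => 4 * A x := by
    funext x
    have h2 : (u x : ℝ) - (2 : ℝ) ^ (k + 3) * signOf (f x) = (((u x - 2 ^ (k + 3) * sZ (f x) : ℤ)) : ℝ) := by
      push_cast; rw [tp_sZ_cast]
    rw [h2]
    by_cases hx : x ∈ P
    · simp only [A, if_pos hx]; rw [hFe x]; push_cast; ring
    · simp only [A, if_neg hx]; rw [hF0 x hx]; norm_num
  have hpair := zms_pairing (k + 3) f g u hu
  rw [hAτ] at hpair
  have hpair' : ∑ y, signOf (g y) * W A y = (2 : ℝ) ^ (8 * k + 22) := by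
    have e2 : ∀ y, signOf (g y) * W (fun x => 4 * A x) y = 4 * (signOf (g y) * W A y) := fun y => by
      rw [fl1_W_smul]; ring
    rw [sum_congr rfl fun y _ => e2 y, ← mul_sum,
      show (2 : ℝ) ^ (10 * (k + 3)) = 2 ^ (2 * k + 5) * 2 ^ (8 * (k + 3) + 1) by ring, mul_assoc, hTeq] at hpair
    have e3 : (2 : ℝ) ^ (2 * k + 5) * 2 ^ (6 * k + 19) = 4 * 2 ^ (8 * k + 22) := by ring
    rw [e3] at hpair
    linarith
  have hge : (2 : ℝ) ^ (8 * k + 22) ≤ ∑ y, |W A y| := by rw [← hpair']; exact fl1_pairing_le_l1 g (W A)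
  have hsq : ((2 : ℝ) ^ (8 * k + 22)) ^ 2 ≤ (∑ y, |W A y|) ^ 2 := pow_le_pow_left₀ (by positivity) hge 2
  have hEn : (∑ y, |W A y|) ^ 2 ≤ (2 : ℝ) ^ (12 * k + 38) := by
    refine hE.trans (le_of_eq ?_)
    rw [show (3 * (k + 3) + 3 * (k + 3)) = 6 * k + 18 by ring]
    ring
  have hbig : (2 : ℝ) ^ (12 * k + 38) < ((2 : ℝ) ^ (8 * k + 22)) ^ 2 := by
    have e2 : ((2 : ℝ) ^ (8 * k + 22)) ^ 2 = 2 ^ (12 * k + 38) * 2 ^ (4 * k + 6) := by ring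
    rw [e2]
    have h1 : (1 : ℝ) < 2 ^ (4 * k + 6) := one_lt_pow₀ (by norm_num) (by omega)
    have h2 : (0 : ℝ) < 2 ^ (12 * k + 38) := by positivity
    exact lt_mul_of_one_lt_right h2 h1
  linarith

end Summit.QuantumAdvantage.QuantumAdvantage.Theorems.CubicForrelation.NearExactIsExact

end
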